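import Summits.CriticalPhenomena.PercolationContinuityZ3.Theorems.PercNearOneGluingNoHeavyLowerTailMajorityGluingTypeTableBottomRegimeA
import HarnessLib

/-!
# THEOREM BOTTOM of the abstract `(4,3)` programme — regime B1 with dominant relay `v_2`
(lane prim-rate, constants-miner 1, gen 27; CLEAN-CERTIFICATES.md §8, THEOREM BOTTOM, regime B1 «K ≤ ½T_w»)

Support file for the closed crux `NoHeavyLowerTail` (stmt-CriticalPhenomena-4575), majority-gluing line; continuation of
`…TypeTableBottomRegimeA` (conventions there).  Regime B1 of THEOREM BOTTOM for the dominant relay `w = 2` (the other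
relays `1, 3, 4`): from the budgets, the normalisation, the three hub-triple rows avoiding `v_2`, the three relay-
triple rows through `v_2`, ISO₄ in profile form and the STAR_2 θ-form (`θ = ½`, an implication discharged by
`star2_theta`), if `T_z ≤ T_2` for all `z` and `K ≤ ½T_2` then
`E ≤ max{(1/14)((6(1+4^{1/c₃}))^{c₃})^{1/(c₃−2)}·M^{√3}, (2^{c₄}·4320)^{1/(2c₄−4)}·M^{(4−c₄)/(2c₄−4)}}`
(case A: the `KS_w` bootstrap through the `w`-free hub triples and the relay triples, `E ≤ t ≤ u/14`; case B: junk
`< 10t`, profiles `S_z + T_z ≤ 12t`, `S_w + T_w ≤ 2.5T_w`, ISO₄ and STAR_w give `T_w^{2c₄−4} ≤ 2^{c₄}·4320·M^{4−c₄}`).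
The four files `…BottomB1W1..4` are the same proof with the relays relabelled.  No definitions, no sorries.
[cite: VandenbergHaggstromKahn2005, Thm. 1.3 (p. 6)]
-/

namespace Summit.CriticalPhenomena.PercolationContinuityZ3.Theorems

namespace HubOnly
namespace TypeTable

noncomputable section
open DType

/-! ### Regime B1, dominant relay `w = 2` -/

/-- **THEOREM BOTTOM, regime B1 with dominant relay `v_2` (CLEAN-CERTIFICATES §8).**  Let `x ≥ 0` be a law with the
budgets, the normalisation `x(v₁ cut) ≤ 1`, the hub-triple rows ISO₃ for the three pairs avoiding `v_2`, the relay-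
triple rows ISO₃ for the three triples through `v_2` (`u_{wab}^{c₃} ≤ M^{3−c₃}·ρ_w·ρ_a·ρ_b`, lists `[2, a, b]`), ISO₄ for the four relays in
the profile form `u₁₂₃₄^{c₄} ≤ M^{4−c₄}·Π_z(S_z + T_z)` (factor of `v_2` first), and the STAR_2 θ-form with `θ = ½` available whenever
`T_2 > 0` and `S_2 ≤ (3/2)T_2` (`star2_theta` applied to the rows; passed as an implication).  If `v_2` is the dominant
relay (`T_z ≤ T_2`) and `K ≤ ½T_2`, then
`E ≤ max{ (1/14)·((6(1+4^{1/c₃}))^{c₃})^{1/(c₃−2)}·M^{√3} , (2^{c₄}·4320)^{1/(2c₄−4)}·M^{(4−c₄)/(2c₄−4)} }`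
(`= max{5.9·10⁶·M^{1.732}, 6.06·10⁴·M^{1.6861}}`). -/
theorem bottom_regime_B1_w2 (x : DType → ℝ) (hx : ∀ τ, 0 ≤ x τ) {M : ℝ} (hM : 0 < M)
    (hB2 : lin (fun τ => τ.bud 2) x ≤ 0) (hB3 : lin (fun τ => τ.bud 3) x ≤ 0)
    (hB4 : lin (fun τ => τ.bud 4) x ≤ 0) (hnorm : lin (fun τ => τ.cutZ 1) x ≤ 1)
    (isoH : ∀ a ∈ [1, 3, 4], ∀ b ∈ [1, 3, 4], a < b →
      uS [0, a, b] x ^ ((3 + Real.sqrt 3) / 2) ≤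
        M ^ (3 - (3 + Real.sqrt 3) / 2) * Rho0 a b x * Pim a b x * Pim b a x)
    (isoR : ∀ a ∈ [1, 3, 4], ∀ b ∈ [1, 3, 4], a < b →
      uS [2, a, b] x ^ ((3 + Real.sqrt 3) / 2) ≤
        M ^ (3 - (3 + Real.sqrt 3) / 2) * lin (fun τ => ind (τ.rho [2, a, b] 2)) x *
          lin (fun τ => ind (τ.rho [2, a, b] a)) x * lin (fun τ => ind (τ.rho [2, a, b] b)) x)
    (iso4 : uS [1, 2, 3, 4] x ^ ((3 + Real.sqrt (11 / 3)) / 2) ≤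
      M ^ (4 - (3 + Real.sqrt (11 / 3)) / 2) * (Sm 2 x + Tm 2 x) * (Sm 1 x + Tm 1 x) * (Sm 3 x + Tm 3 x)
        * (Sm 4 x + Tm 4 x))
    (hstar : 0 < Tm 2 x → Sm 2 x ≤ (2 - 1 / 2) * Tm 2 x →
      ACm x * (3 * E x) ≤ ACm x * uS [1, 2, 3, 4] x - 1 / 2 * (Tm 2 x * (Tm 1 x + Tm 3 x + Tm 4 x)))
    (hdom : ∀ z ∈ [1, 2, 3, 4], Tm z x ≤ Tm 2 x) (hK : Km x ≤ Tm 2 x / 2) :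
    E x ≤ max ((1 / 14) * (((6 * (1 + (4 : ℝ) ^ ((3 + Real.sqrt 3) / 2)⁻¹)) ^ ((3 + Real.sqrt 3) / 2)) ^
        ((3 + Real.sqrt 3) / 2 - 2)⁻¹ * M ^ Real.sqrt 3))
      (((2 : ℝ) ^ ((3 + Real.sqrt (11 / 3)) / 2) * 4320) ^ (2 * ((3 + Real.sqrt (11 / 3)) / 2) - 4)⁻¹ *
        M ^ ((4 - (3 + Real.sqrt (11 / 3)) / 2) / (2 * ((3 + Real.sqrt (11 / 3)) / 2) - 4))) := by
  have h1lt : (1:ℝ) < Real.sqrt 3 := by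
    rw [show (1:ℝ) = Real.sqrt 1 by simp]; exact Real.sqrt_lt_sqrt (by norm_num) (by norm_num)
  have hc2 : (2:ℝ) < ((3 + Real.sqrt 3) / 2) := by linarith
  have hc0 : (0:ℝ) < ((3 + Real.sqrt 3) / 2) := by linarith
  obtain ⟨hd2, hd3⟩ := c4_bounds
  have h4c : 0 ≤ (4 : ℝ) ^ ((3 + Real.sqrt 3) / 2)⁻¹ := Real.rpow_nonneg (by norm_num) _
  have hA0 : 0 ≤ (1 / 14) * (((6 * (1 + (4 : ℝ) ^ ((3 + Real.sqrt 3) / 2)⁻¹)) ^ ((3 + Real.sqrt 3) / 2)) ^ (((3 + Real.sqrt 3) / 2) - 2)⁻¹ * M ^ Real.sqrt 3) := by positivity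
  have hB0 : 0 ≤ ((2 : ℝ) ^ ((3 + Real.sqrt (11 / 3)) / 2) * 4320) ^ (2 * ((3 + Real.sqrt (11 / 3)) / 2) - 4)⁻¹ * M ^ ((4 - ((3 + Real.sqrt (11 / 3)) / 2)) / (2 * ((3 + Real.sqrt (11 / 3)) / 2) - 4)) := by positivity
  by_cases hE : E x ≤ 0
  · exact hE.trans (le_max_of_le_left hA0)
  push Not at hE
  -- layers, controls, supports
  have hET := E_le_T_all x hx hB2 hB3 hB4
  have hctrl := ctrl_le x hB2 hB3 hB4
  have hT1 : 0 < Tm 2 x := lt_of_lt_of_le hE (hET 2 (by simp))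
  have hT2 := hET 1 (by simp); have hT3 := hET 3 (by simp); have hT4 := hET 4 (by simp)
  have hd2' := hdom 1 (by simp); have hd3' := hdom 3 (by simp); have hd4' := hdom 4 (by simp)
  have hK0 : 0 ≤ Km x := lin_ind_nonneg _ hx
  set t := max (Tm 1 x) (max (Tm 3 x) (Tm 4 x)) with ht_def
  have ht2 : Tm 1 x ≤ t := le_max_left _ _
  have ht3 : Tm 3 x ≤ t := (le_max_left _ _).trans (le_max_right _ _)
  have ht4 : Tm 4 x ≤ t := (le_max_right _ _).trans (le_max_right _ _)
  have htT : t ≤ Tm 2 x := max_le hd2' (max_le hd3' hd4')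
  have hEt : E x ≤ t := hT2.trans ht2
  have ht0 : 0 < t := lt_of_lt_of_le hE hEt
  have htsum : t ≤ Tm 1 x + Tm 3 x + Tm 4 x := by
    have := lin_ind_nonneg (fun τ => τ.isT 1) hx; have := lin_ind_nonneg (fun τ => τ.isT 3) hx
    have := lin_ind_nonneg (fun τ => τ.isT 4) hx
    rw [ht_def]; rcases le_total (Tm 1 x) (max (Tm 3 x) (Tm 4 x)) with h | h
    · rw [max_eq_right h]; rcases le_total (Tm 3 x) (Tm 4 x) with h' | h'
      · rw [max_eq_right h']; simp only [Tm] at *; linarith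
      · rw [max_eq_left h']; simp only [Tm] at *; linarith
    · rw [max_eq_left h]; simp only [Tm] at *; linarith
  set KS := lin (fun τ => ind (τ.isKS 2)) x with hKS_def
  have hKS0 : 0 ≤ KS := lin_ind_nonneg _ hx
  -- (S2): supports among the other three relays ≤ 2t + KS
  have hpi : ∀ a ∈ [1, 3, 4], ∀ b ∈ [1, 3, 4], a ≠ b → Pim a b x ≤ 2 * t + KS := by
    intro a ha b hb hab
    have ha' : a ∈ [1, 2, 3, 4] := mem_relays_of_mem3 (by simp) (by simp) (by simp) ha
    have hb' : b ∈ [1, 2, 3, 4] := mem_relays_of_mem3 (by simp) (by simp) (by simp) hb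
    have ha1 : a ≠ 2 := by rintro rfl; simp at ha
    have hb1 : b ≠ 2 := by rintro rfl; simp at hb
    have h := cc_bound _ x (fun τ hτ => S2_combo τ hτ 2 (by simp) a ha' b hb' hab ha1 hb1) hx
    have h2 := cc_bound _ x (fun τ hτ => (piSupp_combo τ hτ a ha' b hb' hab).2) hx
    simp only [List.map_cons, List.map_nil, List.sum_cons, List.sum_nil] at h h2
    push_cast at h h2
    have hca := hctrl a ha'
    have hTa : Tm a x ≤ t := by
      simp only [List.mem_cons, List.not_mem_nil, or_false] at ha
      rcases ha with rfl | rfl | rfl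
      · exact ht2
      · exact ht3
      · exact ht4
    have hTb : Tm b x ≤ t := by
      simp only [List.mem_cons, List.not_mem_nil, or_false] at hb
      rcases hb with rfl | rfl | rfl
      · exact ht2
      · exact ht3
      · exact ht4
    simp only [Pim, Tm] at *
    linarith
  set u := 4 * t + KS with hu_def
  have hu0 : 0 ≤ u := by linarith
  have h2tu : 2 * t + KS ≤ u := by rw [hu_def]; linarith
  -- relay supports ρ_a^{wab} ≤ u, ρ_w^{wab} ≤ 4
  have hcut := cut_le_one x hx hnorm hB2 hB3 hB4
  have hrhoR : ∀ a ∈ [1, 3, 4], ∀ b ∈ [1, 3, 4], a ≠ b →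
      lin (fun τ => ind (τ.rho [2, a, b] a)) x ≤ u ∧ lin (fun τ => ind (τ.rho [2, a, b] 2)) x ≤ 4 := by
    intro a ha b hb hab
    have ha' : a ∈ [1, 2, 3, 4] := mem_relays_of_mem3 (by simp) (by simp) (by simp) ha
    have hb' : b ∈ [1, 2, 3, 4] := mem_relays_of_mem3 (by simp) (by simp) (by simp) hb
    have ha1 : a ≠ 2 := by rintro rfl; simp at ha
    have hb1 : b ≠ 2 := by rintro rfl; simp at hb
    have h := cc_bound _ x (fun τ hτ => (S4_S5_combo τ hτ 2 (by simp) a ha' b hb' hab ha1 hb1).1) hx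
    have h1 := cc_bound _ x (fun τ hτ => (budget_combo' τ hτ).2.1 2 (by simp) a ha' b hb' hab ha1 hb1) hx
    simp only [List.map_cons, List.map_nil, List.sum_cons, List.sum_nil] at h h1
    push_cast at h h1
    have hp := hpi a ha b hb hab
    have hcb := hctrl b hb'
    have hTa : Tm a x ≤ t := by
      simp only [List.mem_cons, List.not_mem_nil, or_false] at ha
      rcases ha with rfl | rfl | rfl
      · exact ht2
      · exact ht3
      · exact ht4
    have hTb : Tm b x ≤ t := by
      simp only [List.mem_cons, List.not_mem_nil, or_false] at hb
      rcases hb with rfl | rfl | rfl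
      · exact ht2
      · exact ht3
      · exact ht4
    have c1 := hcut 1 (by simp); have c2 := hcut 2 (by simp); have c3 := hcut 3 (by simp); have c4 := hcut 4 (by simp)
    simp only [Pim, Tm] at *
    constructor <;> linarith
  -- ISO₃ caps: hub triples ≤ H, relay triples ≤ 4^{1/c} H, H = (u² M^{b₃})^{1/c}
  have hm : 0 ≤ M ^ (3 - ((3 + Real.sqrt 3) / 2)) := Real.rpow_nonneg hM.le _
  set H := (u ^ 2 * M ^ (3 - ((3 + Real.sqrt 3) / 2))) ^ ((3 + Real.sqrt 3) / 2)⁻¹ with hH_def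
  have hH0 : 0 ≤ H := Real.rpow_nonneg (mul_nonneg (sq_nonneg u) hm) _
  have hrho0 := rho0_le_one x hx hnorm hB2 hB3 hB4
  have hhub : ∀ a ∈ [1, 3, 4], ∀ b ∈ [1, 3, 4], a < b → uS [0, a, b] x ≤ H := by
    intro a ha b hb hab
    have ha' : a ∈ [1, 2, 3, 4] := mem_relays_of_mem3 (by simp) (by simp) (by simp) ha
    have hb' : b ∈ [1, 2, 3, 4] := mem_relays_of_mem3 (by simp) (by simp) (by simp) hb
    have hne : a ≠ b := ne_of_lt hab
    have h := triple_root (R := 1) (P := u) (lin_ind_nonneg _ hx) hc0 hm (lin_ind_nonneg _ hx)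
      (hrho0 a ha' b hb' hne) (lin_ind_nonneg _ hx) ((hpi a ha b hb hne).trans h2tu) (lin_ind_nonneg _ hx)
      ((hpi b hb a ha hne.symm).trans h2tu) (isoH a ha b hb hab)
    rw [one_mul, ← hH_def] at h
    exact h
  have hrel : ∀ a ∈ [1, 3, 4], ∀ b ∈ [1, 3, 4], a < b → uS [2, a, b] x ≤ (4 : ℝ) ^ ((3 + Real.sqrt 3) / 2)⁻¹ * H := by
    intro a ha b hb hab
    have hne : a ≠ b := ne_of_lt hab
    have hra := hrhoR a ha b hb hne
    have hrb := (hrhoR b hb a ha hne.symm).1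
    -- ρ_b^{wab}: the fact is stated with the list [w, b, a]; convert
    have hba : ∀ τ ∈ allTypes, ind (τ.rho [2, a, b] b) = ind (τ.rho [2, b, a] b) := fun τ hτ => by
      rw [((rho_perm3 τ hτ 2 (by simp) a (List.mem_cons_of_mem 0 (mem_relays_of_mem3 (by simp) (by simp) (by simp) ha)) b
        (List.mem_cons_of_mem 0 (mem_relays_of_mem3 (by simp) (by simp) (by simp) hb))).2 b)]
    have hrb' : lin (fun τ => ind (τ.rho [2, a, b] b)) x ≤ u := by
      rw [lin_congr hba x]; exact hrb
    have h := triple_root (R := 4) (P := u) (lin_ind_nonneg _ hx) hc0 hm (lin_ind_nonneg _ hx) hra.2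
      (lin_ind_nonneg _ hx) hra.1 (lin_ind_nonneg _ hx) hrb' (isoR a ha b hb hab)
    rw [mul_assoc, root_four_mul (mul_nonneg (sq_nonneg u) hm), ← hH_def] at h
    exact h
  -- KS ≤ 3t + 3(1 + 4^{1/c}) H
  have hKS : KS ≤ 3 * t + 3 * (1 + (4 : ℝ) ^ ((3 + Real.sqrt 3) / 2)⁻¹) * H := by
    have h := cc_bound _ x (fun τ hτ => (S3_combo τ hτ).2.1) hx
    have hj := cc_bound _ x (fun τ hτ => (J2_le_relayTriples_combo τ hτ).2.1) hx
    simp only [List.map_cons, List.map_nil, List.sum_cons, List.sum_nil] at h hj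
    push_cast at h hj
    have u23 := hhub 1 (by simp) 3 (by simp) (by norm_num); have u24 := hhub 1 (by simp) 4 (by simp) (by norm_num)
    have u34 := hhub 3 (by simp) 4 (by simp) (by norm_num)
    have r23 := hrel 1 (by simp) 3 (by simp) (by norm_num); have r24 := hrel 1 (by simp) 4 (by simp) (by norm_num)
    have r34 := hrel 3 (by simp) 4 (by simp) (by norm_num)
    have c2 := hctrl 1 (by simp); have c3 := hctrl 3 (by simp); have c4 := hctrl 4 (by simp)
    simp only [uS, Tm] at *
    linarith
  by_cases hcase : 10 * t ≤ KS
  · -- Case A: u ≤ 2c*·H, bootstrap on u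
    have hu14 : 14 * t ≤ u := by rw [hu_def]; linarith
    have hboot0 : u ≤ (6 * (1 + (4 : ℝ) ^ ((3 + Real.sqrt 3) / 2)⁻¹)) * (M ^ (3 - ((3 + Real.sqrt 3) / 2)) * u ^ 2) ^ ((3 + Real.sqrt 3) / 2)⁻¹ := by
      have e : M ^ (3 - ((3 + Real.sqrt 3) / 2)) * u ^ 2 = u ^ 2 * M ^ (3 - ((3 + Real.sqrt 3) / 2)) := by ring
      rw [e, ← hH_def, hu_def]
      linarith
    have hCpos : 0 < 6 * (1 + (4 : ℝ) ^ ((3 + Real.sqrt 3) / 2)⁻¹) := by positivity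
    have hboot := iso3_bootstrap hu0 (Real.rpow_pos_of_pos hM _) hc2 hCpos hboot0
    rw [Real.mul_rpow (by positivity) hm, rpow_b3_root M hM.le] at hboot
    refine le_max_of_le_left ?_
    have : E x ≤ u / 14 := by rw [le_div_iff₀ (by norm_num)]; linarith
    refine this.trans ?_
    rw [div_le_iff₀ (by norm_num)]
    have := mul_le_mul_of_nonneg_left hboot (by norm_num : (0:ℝ) ≤ 1 / 14)
    linarith
  · -- Case B: KS < 10t; junk, profiles, ISO₄ + STAR
    push Not at hcase
    refine le_max_of_le_right ?_
    have hjunk : ∀ z ∈ [1, 3, 4], Sm z x + Tm z x ≤ 12 * t := by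
      intro z hz
      have hz' : z ∈ [1, 2, 3, 4] := mem_relays_of_mem3 (by simp) (by simp) (by simp) hz
      have hz1 : z ≠ 2 := by rintro rfl; simp at hz
      have h1 := cc_bound _ x (fun τ hτ => S_le_ctrl_junk_combo τ hτ z hz') hx
      have h2 := cc_bound _ x (fun τ hτ => (S4_S5_combo τ hτ 2 (by simp) z hz' (if z = 1 then 3 else 1)
        (by simp only [List.mem_cons]; split <;> simp) (by split <;> omega) hz1 (by split <;> omega)).2) hx
      simp only [List.map_cons, List.map_nil, List.sum_cons, List.sum_nil] at h1 h2
      push_cast at h1 h2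
      have hc := hctrl z hz'
      have hTz : Tm z x ≤ t := by
        simp only [List.mem_cons, List.not_mem_nil, or_false] at hz
        rcases hz with rfl | rfl | rfl
        · exact ht2
        · exact ht3
        · exact ht4
      simp only [Sm, Tm] at *
      linarith
    have hj1 : Sm 2 x ≤ (3 / 2) * Tm 2 x := by
      have h1 := cc_bound _ x (fun τ hτ => S_le_ctrl_junk_combo τ hτ 2 (by simp)) hx
      have h2 := cc_bound _ x (fun τ hτ => (budget_combo' τ hτ).2.2 2 (by simp)) hx
      simp only [List.map_cons, List.map_nil, List.sum_cons, List.sum_nil] at h1 h2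
      push_cast at h1 h2
      have hc := hctrl 2 (by simp)
      simp only [Sm, Tm, Km] at *
      linarith
    -- STAR_w with θ = ½ and x(all cut) ≤ 1: T_w Σ_{z≠w} T_z ≤ 2 U₄
    have hAC1 : ACm x ≤ 1 := by
      have h := cc_bound _ x (fun τ hτ => (budget_combo' τ hτ).1) hx
      simp only [List.map_cons, List.map_nil, List.sum_cons, List.sum_nil] at h
      push_cast at h; simp only [ACm]; linarith
    have hAC0 : 0 ≤ ACm x := lin_ind_nonneg _ hx
    have hU0 : 0 ≤ uS [1, 2, 3, 4] x := lin_ind_nonneg _ hx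
    have hs := hstar hT1 (by linarith)
    have hTt : Tm 2 x * t ≤ 2 * uS [1, 2, 3, 4] x := by
      have h0 := mul_nonneg hAC0 hE.le
      have h1 : 1 / 2 * (Tm 2 x * (Tm 1 x + Tm 3 x + Tm 4 x)) ≤ ACm x * uS [1, 2, 3, 4] x := by linarith
      have h2' := mul_nonneg (sub_nonneg.mpr hAC1) hU0
      have h2 : ACm x * uS [1, 2, 3, 4] x ≤ uS [1, 2, 3, 4] x := by linarith
      have h3 := mul_le_mul_of_nonneg_left htsum hT1.le
      linarith
    -- ISO₄ with the profile bounds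
    have hmd : 0 ≤ M ^ (4 - ((3 + Real.sqrt (11 / 3)) / 2)) := Real.rpow_nonneg hM.le _
    have hS0 : ∀ z, 0 ≤ Sm z x := fun z => lin_ind_nonneg _ hx
    have hP1 : Sm 2 x + Tm 2 x ≤ (5 / 2) * Tm 2 x := by linarith
    have hV : uS [1, 2, 3, 4] x ^ ((3 + Real.sqrt (11 / 3)) / 2) ≤ M ^ (4 - ((3 + Real.sqrt (11 / 3)) / 2)) * ((5 / 2) * Tm 2 x) * (12 * t) * (12 * t) * (12 * t) :=
      iso4.trans (prod4_mono hmd (add_nonneg (hS0 2) (lin_ind_nonneg _ hx)) hP1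
        (add_nonneg (hS0 1) (lin_ind_nonneg _ hx)) (hjunk 1 (by simp))
        (add_nonneg (hS0 3) (lin_ind_nonneg _ hx)) (hjunk 3 (by simp))
        (add_nonneg (hS0 4) (lin_ind_nonneg _ hx)) (hjunk 4 (by simp)))
    -- (T_w t)^d ≤ 2^d U₄^d ≤ 2^d M^{4-d} (5/2) 1728 T_w t³
    have hTt' : (Tm 2 x * t) ^ ((3 + Real.sqrt (11 / 3)) / 2) ≤ ((2 : ℝ) ^ ((3 + Real.sqrt (11 / 3)) / 2) * 4320 * M ^ (4 - ((3 + Real.sqrt (11 / 3)) / 2))) * Tm 2 x * t ^ 3 := by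
      have h1 : (Tm 2 x * t) ^ ((3 + Real.sqrt (11 / 3)) / 2) ≤ (2 * uS [1, 2, 3, 4] x) ^ ((3 + Real.sqrt (11 / 3)) / 2) :=
        Real.rpow_le_rpow (mul_nonneg hT1.le ht0.le) hTt (by linarith)
      rw [Real.mul_rpow (by norm_num) hU0] at h1
      have h2 := mul_le_mul_of_nonneg_left hV (Real.rpow_nonneg (by norm_num : (0:ℝ) ≤ 2) ((3 + Real.sqrt (11 / 3)) / 2))
      refine h1.trans (h2.trans (le_of_eq ?_)); ring
    have hsol := iso4_solve ht0 htT hd2 hd3 hTt'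
    rw [Real.mul_rpow (by positivity) hmd, ← Real.rpow_mul hM.le] at hsol
    rw [show (4 - ((3 + Real.sqrt (11 / 3)) / 2)) / (2 * ((3 + Real.sqrt (11 / 3)) / 2) - 4) = (4 - ((3 + Real.sqrt (11 / 3)) / 2)) * (2 * ((3 + Real.sqrt (11 / 3)) / 2) - 4)⁻¹ from div_eq_mul_inv _ _]
    exact (hET 2 (by simp)).trans hsol

end

end TypeTable
end HubOnly

end Summit.CriticalPhenomena.PercolationContinuityZ3.Theorems
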